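import Mathlib
import Summits.ValiantsHypothesis.ValiantsHypothesis.Theorems.LacunarySymmetroidMatrixDescartesCensusLogPrimesTable

/-!
# `MatrixDescartes` census — W4 boundary layer: closed NUMERAL FACTS for the kernel kill of `ZP(3..18)` on `(0,3,4,10,22,37)`

HONEST FRAMING.  Object-search cell `pub-symmetroid`, item `DoorA26 = PosRootLawAt 2 6 19` (stmt-ValiantsHypothesis-19979, OPEN, typed,
never asserted).  Companion («Rows») file of `…CensusZp318On…` (theorem `countP_posRoots_zp_3_18_le_on_0_3_4_10_22_37`): the numeric side
conditions of its typed face-row-LP certificate — for every weighted circuit row `(r,s,u)` the three integer twist multipliers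
`|∏_{v ∉ {r,s,u}} (e_t − e_v)|` over the exponent table (a list literal), each in its OWN declaration (own heartbeat budget), by
`norm_num` (the leaves themselves close over the certified log table, so no row constant `L, R` or leaf numeral is needed).  Pure arithmetic; generated by the seat tool `tools/kernel/genzp3.py`.  Nothing here is a statement about pencils.

[folklore] Integer arithmetic; no source.
-/

-- `Summit.ValiantsHypothesis.ValiantsHypothesis.…` repeats a component by the D-0017 layout
-- (single-conjunct summit), which the `dupNamespace` linter flags; the name is mandated.
set_option linter.dupNamespace false

namespace Summit.ValiantsHypothesis.ValiantsHypothesis.Theorems.LacunarySymmetroidMatrixDescartes.Census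

open Finset

/-- The three integer twist multipliers `|∏ (e_t − e_v)|`, `t ∈ {r,s,u} = {11,12,13}`, over the exponent table of the typed certificate (generated; own declaration = own heartbeat budget). [folklore] -/
theorem zp_3_18_on_0_3_4_10_22_37_mult_11_12_13 :
    |∏ v ∈ (range 16).filter (fun v => ¬(v = 11 ∨ v = 12 ∨ v = 13)), (((([6, 7, 8, 10, 13, 14, 20, 22, 25, 26, 32, 37, 40, 41, 44, 47] : List ℕ).getD 11 0 : ℕ) : ℝ) - (([6, 7, 8, 10, 13, 14, 20, 22, 25, 26, 32, 37, 40, 41, 44, 47] : List ℕ).getD v 0 : ℕ))| = 4735501127280000 ∧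
    |∏ v ∈ (range 16).filter (fun v => ¬(v = 11 ∨ v = 12 ∨ v = 13)), (((([6, 7, 8, 10, 13, 14, 20, 22, 25, 26, 32, 37, 40, 41, 44, 47] : List ℕ).getD 12 0 : ℕ) : ℝ) - (([6, 7, 8, 10, 13, 14, 20, 22, 25, 26, 32, 37, 40, 41, 44, 47] : List ℕ).getD v 0 : ℕ))| = 12804747411456000 ∧
    |∏ v ∈ (range 16).filter (fun v => ¬(v = 11 ∨ v = 12 ∨ v = 13)), (((([6, 7, 8, 10, 13, 14, 20, 22, 25, 26, 32, 37, 40, 41, 44, 47] : List ℕ).getD 13 0 : ℕ) : ℝ) - (([6, 7, 8, 10, 13, 14, 20, 22, 25, 26, 32, 37, 40, 41, 44, 47] : List ℕ).getD v 0 : ℕ))| = 14277216412166400 :=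
  ⟨by rw [Finset.prod_filter]; simp only [Finset.prod_range_succ, Finset.prod_range_zero, List.getD_eq_getElem?_getD]; norm_num,
   by rw [Finset.prod_filter]; simp only [Finset.prod_range_succ, Finset.prod_range_zero, List.getD_eq_getElem?_getD]; norm_num,
   by rw [Finset.prod_filter]; simp only [Finset.prod_range_succ, Finset.prod_range_zero, List.getD_eq_getElem?_getD]; norm_num⟩

end Summit.ValiantsHypothesis.ValiantsHypothesis.Theorems.LacunarySymmetroidMatrixDescartes.Census
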